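import Summits.RiemannHypothesis.RiemannHypothesis.Theorems.GroundBartaEvenWinsBeyondArchDeflationN83ELast
import Summits.RiemannHypothesis.RiemannHypothesis.Theorems.GroundBartaEvenWinsBeyondArchDeflationN83OLast
import Summits.RiemannHypothesis.RiemannHypothesis.Theorems.WeilParityEvenWinsBeyondArchFrontierCell7OfBlocks
import HarnessLib

/-!
# RiemannHypothesis / GroundBarta — rung 4 (`EvenWinsBeyondArch`): the window `c = 83/100` CLOSED —
# `WeilPositivityOn (83/100)` and `0 ≤ weilGroundEnergy (83/100)`

Helper file (`--supports stmt-RiemannHypothesis-18085`), RH-free, no named facts.  Prover A g12 (unit `sr-gb-rung-a`).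
The two block theorems at `c = 83/100` (…N83ELast: `0 ≤ ε_ev(83/100)`; …N83OLast: `2/10^17 ≤ ε_od(83/100)`; A-layers,
phantom two-prime certificate C83X, four-slot R-layers RN83E/RN83O, three-zone weighted cross-Gram criteria) fed into the
landed closure `…FrontierCell7OfBlocks` (p307654): Weil positivity of the explicit-formula quadratic form on every test
function supported in `[-83/100, 83/100]`, and non-negativity of the bottom of Weil's form on `[-83/100, 83/100]` (the first window beyond the three-prime endpoint `(log 5)/2`:
prime powers `2, 3, 4, 5` visible).  The parity cell (`WeilWindowSimpleEven` up to `83/100`, odd block only) is `…N83OddCell`.  Prover A g12/g13.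
-/

set_option linter.dupNamespace false

noncomputable section

namespace Summit.RiemannHypothesis.RiemannHypothesis.Theorems.EvenWinsBeyondArch

open Literature.NumberTheory.LFunctions

/-- **Weil positivity on `C[-83/100, 83/100]`.** [folklore] -/
theorem weilPositivityOn_83 : WeilPositivityOn (83 / 100) :=
  weilPositivityOn_83_of_blocks n83E_evenLower_lit (le_trans (by norm_num) n83O_oddLower_lit)

/-- The bottom of Weil's form on `[-83/100, 83/100]` is non-negative. [folklore] -/
theorem weilGroundEnergy_83_nonneg : 0 ≤ weilGroundEnergy (83 / 100) :=
  weilGroundEnergy_83_nonneg_of_blocks n83E_evenLower_lit (le_trans (by norm_num) n83O_oddLower_lit)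

end Summit.RiemannHypothesis.RiemannHypothesis.Theorems.EvenWinsBeyondArch

end
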